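import Mathlib
import HarnessLib

/-!
# Approximations to functions from indefinite integrals: `arctan` as a Gauss-rule target, `eᶻ E_m(z)` as a
Laguerre-rule target, and the Taylor remainder of `eˣ` as the integral of a spline
(Davis–Rabinowitz 1984, Sect. 2.13.2)

**Source.** P. J. Davis, P. Rabinowitz, *Methods of Numerical Integration* (2nd ed., Academic Press, 1984),
Sect. 2.13.2 "Indefinite Integration and Approximation", the three worked examples and formulas
(2.13.2.1)–(2.13.2.4).

**Statement.** Indefinite integrals, or integrals depending on a parameter, turn an integration RULE into an
APPROXIMATION FORMULA for a function.  The three examples of the text rest on the following exact identities,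
which are what is formalised here.

* `arctan x = ∫₀ˣ dt/(1+t²) = 2x ∫_{-1}^{1} du / (4 + x²(u+1)²)` for every real `x` (the substitution
  `t = x(u+1)/2` carries `[0, x]` to the fixed interval `[-1, 1]`; `arctan_eq_integral_inv_one_add_sq`,
  `arctan_eq_two_mul_integral`); applying the 5-point Gauss rule to the right-hand side gives (2.13.2.1).  The
  data printed there are those of the Gauss–Legendre rule `G₅`: nodes `0, ±x₂, ±x₁` with
  `x₁² = (35 + 2√70)/63`, `x₂² = (35 - 2√70)/63`, weights `w₁ = (322 - 13√70)/900`, `w₂ = (322 + 13√70)/900` and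
  centre weight `2 - 2w₁ - 2w₂ = 128/225` (`gauss5_centre_weight`); we certify the decimals
  `x₁ = .90617985`, `w₁ = .23692689`, `x₂ = .53846931`, `w₂ = .47862867` to the printed 8 places
  (`gauss5_node₁_approx`, …) and the exactness of `G₅` on `1, x², x⁴, x⁶, x⁸` (odd monomials are automatic by
  symmetry), i.e. degree of precision `9` (`gauss5_moments`).
* For real `z > 0` and any natural `m`, `E_m(z) = ∫_z^∞ e^{-t} t^{-m} dt` (2.13.2.2) satisfies
  `eᶻ E_m(z) = ∫₀^∞ e^{-u} (u+z)^{-m} du` (2.13.2.3) (`exp_mul_expIntegralE_eq`), the form to which the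
  Gauss–Laguerre rule is applied in (2.13.2.4).
* `eˣ = 1 + x + x²/2! + x³/3! + (1/3!) ∫₀¹ eᵗ (x - t)₊³ dt` for `0 ≤ x ≤ 1` (`exp_eq_taylor3_add_integral_truncPow`),
  the Taylor formula with its remainder written as the integral of the truncated power ("spline") kernel
  `(x - t)₊³ = max (x - t) 0 ^ 3` over the FIXED interval `[0, 1]`; a compound Simpson rule applied to it yields
  the cubic-spline approximation `P₃ + S₃` of the text.

**Used by / context.** Companion to the tree's Sect. 2.13.1 anchors (Chebyshev-series indefinite integration)
and to the Gauss–Laguerre material of Sect. 3.6; Todd's error bound for (2.13.2.4) and Barrett's rational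
approximations (2.13.2.5)–(2.13.2.6) are not formalised.

**Proof sketch / formalization notes.** `arctan` is Mathlib's `integral_inv_one_add_sq`; the substitution is
`intervalIntegral.integral_comp_mul_add`.  The `G₅` facts are identities in `ℚ(√70)` discharged with
`Real.sq_sqrt` and `nlinarith`/`linear_combination`, the decimals by squeezing `√70` between rationals.  The
`E_m` identity is translation invariance of Lebesgue measure on the indicator of `(z, ∞)`.  The Taylor identity
is the fundamental theorem of calculus for the explicit primitive `t ↦ eᵗ((x-t)³ + 3(x-t)² + 6(x-t) + 6)` on
`[0, x]` plus the vanishing of the kernel on `[x, 1]`.  No `sorry`, no new axioms.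
-/

open Real MeasureTheory intervalIntegral Set

noncomputable section

namespace Literature.Analysis.Quadrature

/-! ### `arctan` as an integral over a fixed interval, and the rule `G₅` of (2.13.2.1) -/

/-- `arctan x = ∫₀ˣ dt / (1 + t²)`. [cite: DavisRabinowitz1984, Sect. 2.13.2 (2.13.2.1)] -/
theorem arctan_eq_integral_inv_one_add_sq (x : ℝ) : arctan x = ∫ t in (0 : ℝ)..x, (1 + t ^ 2)⁻¹ := by
  simp

/-- **The substitution of (2.13.2.1).** For every real `x`,
`arctan x = 2x ∫_{-1}^{1} du / (4 + x² (u+1)²)` (substitute `t = x(u+1)/2`).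
[cite: DavisRabinowitz1984, Sect. 2.13.2 (2.13.2.1)] -/
theorem arctan_eq_two_mul_integral (x : ℝ) :
    arctan x = 2 * x * ∫ u in (-1 : ℝ)..1, 1 / (4 + x ^ 2 * (u + 1) ^ 2) := by
  rcases eq_or_ne x 0 with rfl | hx
  · simp
  have hc : x / 2 ≠ 0 := div_ne_zero hx two_ne_zero
  -- `∫_{-1}^{1} (1 + (x/2·u + x/2)²)⁻¹ du = (x/2)⁻¹ ∫₀ˣ (1+t²)⁻¹ dt`
  have hsub := intervalIntegral.integral_comp_mul_add (fun t : ℝ => (1 + t ^ 2)⁻¹) hc (x / 2)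
    (a := -1) (b := 1)
  have hb0 : x / 2 * -1 + x / 2 = 0 := by ring
  have hb1 : x / 2 * 1 + x / 2 = x := by ring
  rw [hb0, hb1, smul_eq_mul] at hsub
  have hfun : (fun u : ℝ => 1 / (4 + x ^ 2 * (u + 1) ^ 2)) = fun u => (1 / 4) * (1 + (x / 2 * u + x / 2) ^ 2)⁻¹ := by
    funext u
    have h4 : (4 : ℝ) + x ^ 2 * (u + 1) ^ 2 ≠ 0 := by positivity
    have h1 : (1 : ℝ) + (x / 2 * u + x / 2) ^ 2 ≠ 0 := by positivity
    field_simp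
    ring
  rw [hfun, intervalIntegral.integral_const_mul, hsub, arctan_eq_integral_inv_one_add_sq]
  field_simp
  ring

/-- The outer Gauss–Legendre node of `G₅`: `x₁ = √((35 + 2√70)/63)`. [cite: DavisRabinowitz1984, Sect. 2.13.2 (2.13.2.1)] -/
def gauss5Node₁ : ℝ := Real.sqrt ((35 + 2 * Real.sqrt 70) / 63)

/-- The inner Gauss–Legendre node of `G₅`: `x₂ = √((35 - 2√70)/63)`. [cite: DavisRabinowitz1984, Sect. 2.13.2 (2.13.2.1)] -/
def gauss5Node₂ : ℝ := Real.sqrt ((35 - 2 * Real.sqrt 70) / 63)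

/-- The weight of `±x₁` in `G₅`: `w₁ = (322 - 13√70)/900`. [cite: DavisRabinowitz1984, Sect. 2.13.2 (2.13.2.1)] -/
def gauss5Weight₁ : ℝ := (322 - 13 * Real.sqrt 70) / 900

/-- The weight of `±x₂` in `G₅`: `w₂ = (322 + 13√70)/900`. [cite: DavisRabinowitz1984, Sect. 2.13.2 (2.13.2.1)] -/
def gauss5Weight₂ : ℝ := (322 + 13 * Real.sqrt 70) / 900

/-- `(√70)² = 70`. [folklore] -/
private theorem sqrt70_sq : Real.sqrt 70 ^ 2 = 70 := Real.sq_sqrt (by norm_num)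

/-- `8.3666002 < √70 < 8.3666003`. [folklore] -/
private theorem sqrt70_bounds : 8.3666002 < Real.sqrt 70 ∧ Real.sqrt 70 < 8.3666003 := by
  constructor
  · rw [show (8.3666002 : ℝ) = Real.sqrt (8.3666002 ^ 2) by rw [Real.sqrt_sq (by norm_num)]]
    exact Real.sqrt_lt_sqrt (by norm_num) (by norm_num)
  · rw [show (8.3666003 : ℝ) = Real.sqrt (8.3666003 ^ 2) by rw [Real.sqrt_sq (by norm_num)]]
    exact Real.sqrt_lt_sqrt (by positivity) (by norm_num)

/-- **Centre weight of (2.13.2.1):** `2 - 2w₁ - 2w₂ = 128/225` (the weight of the node `0` of `G₅`).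
[cite: DavisRabinowitz1984, Sect. 2.13.2 (2.13.2.1)] -/
theorem gauss5_centre_weight : 2 - 2 * gauss5Weight₁ - 2 * gauss5Weight₂ = 128 / 225 := by
  unfold gauss5Weight₁ gauss5Weight₂
  ring

/-- `x₁² = (35 + 2√70)/63` and `x₂² = (35 - 2√70)/63` (both radicands are positive).
[cite: DavisRabinowitz1984, Sect. 2.13.2 (2.13.2.1)] -/
theorem gauss5Node_sq :
    gauss5Node₁ ^ 2 = (35 + 2 * Real.sqrt 70) / 63 ∧ gauss5Node₂ ^ 2 = (35 - 2 * Real.sqrt 70) / 63 := by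
  obtain ⟨h1, h2⟩ := sqrt70_bounds
  exact ⟨Real.sq_sqrt (by positivity), Real.sq_sqrt (by nlinarith)⟩

/-- **`G₅` has degree of precision 9:** with the data of (2.13.2.1),
`w₀·1 + 2w₁ + 2w₂ = 2` and `2 (w₁ x₁^{2k} + w₂ x₂^{2k}) = 2/(2k+1) = ∫_{-1}^{1} x^{2k} dx` for `k = 1, 2, 3, 4`
(the odd moments vanish by symmetry). [cite: DavisRabinowitz1984, Sect. 2.13.2 (2.13.2.1)] -/
theorem gauss5_moments :
    128 / 225 + 2 * gauss5Weight₁ + 2 * gauss5Weight₂ = 2 ∧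
    2 * (gauss5Weight₁ * gauss5Node₁ ^ 2 + gauss5Weight₂ * gauss5Node₂ ^ 2) = 2 / 3 ∧
    2 * (gauss5Weight₁ * (gauss5Node₁ ^ 2) ^ 2 + gauss5Weight₂ * (gauss5Node₂ ^ 2) ^ 2) = 2 / 5 ∧
    2 * (gauss5Weight₁ * (gauss5Node₁ ^ 2) ^ 3 + gauss5Weight₂ * (gauss5Node₂ ^ 2) ^ 3) = 2 / 7 ∧
    2 * (gauss5Weight₁ * (gauss5Node₁ ^ 2) ^ 4 + gauss5Weight₂ * (gauss5Node₂ ^ 2) ^ 4) = 2 / 9 := by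
  obtain ⟨h1, h2⟩ := gauss5Node_sq
  have h70 := sqrt70_sq
  rw [h1, h2]
  unfold gauss5Weight₁ gauss5Weight₂
  refine ⟨by ring, ?_, ?_, ?_, ?_⟩
  · linear_combination (-(26 : ℝ) / 14175) * h70
  · linear_combination (-(76 : ℝ) / 127575) * h70
  · linear_combination ((926 : ℝ) / 1607445 - 104 / 56260575 * Real.sqrt 70 ^ 2) * h70
  · linear_combination ((2536 : ℝ) / 2066715 - 64 / 24111675 * Real.sqrt 70 ^ 2) * h70

/-- **The decimals of (2.13.2.1):** `x₁ = .90617985`, `x₂ = .53846931` (to the places printed).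
[cite: DavisRabinowitz1984, Sect. 2.13.2 (2.13.2.1)] -/
theorem gauss5Node_approx :
    (0.9061798 < gauss5Node₁ ∧ gauss5Node₁ < 0.9061799) ∧ (0.5384693 < gauss5Node₂ ∧ gauss5Node₂ < 0.5384694) := by
  obtain ⟨h1, h2⟩ := sqrt70_bounds
  have hA : 0 < (35 + 2 * Real.sqrt 70) / 63 := by positivity
  have hB : 0 < (35 - 2 * Real.sqrt 70) / 63 := by nlinarith
  refine ⟨⟨?_, ?_⟩, ?_, ?_⟩
  · rw [gauss5Node₁, Real.lt_sqrt (by norm_num)]; nlinarith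
  · rw [gauss5Node₁, Real.sqrt_lt' (by norm_num)]; nlinarith
  · rw [gauss5Node₂, Real.lt_sqrt (by norm_num)]; nlinarith
  · rw [gauss5Node₂, Real.sqrt_lt' (by norm_num)]; nlinarith

/-- **The decimals of (2.13.2.1):** `w₁ = .23692689`, `w₂ = .47862867` (to the places printed).
[cite: DavisRabinowitz1984, Sect. 2.13.2 (2.13.2.1)] -/
theorem gauss5Weight_approx :
    (0.2369268 < gauss5Weight₁ ∧ gauss5Weight₁ < 0.2369269) ∧
    (0.4786286 < gauss5Weight₂ ∧ gauss5Weight₂ < 0.4786287) := by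
  obtain ⟨h1, h2⟩ := sqrt70_bounds
  unfold gauss5Weight₁ gauss5Weight₂
  refine ⟨⟨?_, ?_⟩, ?_, ?_⟩ <;> linarith

/-! ### The exponential integral `E_m` as a Laguerre-rule target: (2.13.2.2)–(2.13.2.4) -/

/-- The exponential integral `E_m(z) = ∫_z^∞ e^{-t} t^{-m} dt` of (2.13.2.2), for real `z` (as a Lebesgue
integral over `(z, ∞)`). [cite: DavisRabinowitz1984, Sect. 2.13.2 (2.13.2.2)] -/
def expIntegralE (m : ℕ) (z : ℝ) : ℝ := ∫ t in Ioi z, exp (-t) * (t ^ m)⁻¹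

/-- **(2.13.2.3).** `φ(z) = eᶻ E_m(z) = ∫₀^∞ e^{-u} (u + z)^{-m} du` for every real `z` and natural `m`
(substitute `t = u + z`; an identity of Lebesgue integrals, both sides being the junk value `0` together when
they diverge).  The Gauss–Laguerre rule applied to the right-hand side gives (2.13.2.4)
`φ(z) ≈ Σ w_k (x_k + z)^{-m}`. [cite: DavisRabinowitz1984, Sect. 2.13.2 (2.13.2.3), (2.13.2.4)] -/
theorem exp_mul_expIntegralE_eq (m : ℕ) (z : ℝ) :
    exp z * expIntegralE m z = ∫ u in Ioi 0, exp (-u) * ((u + z) ^ m)⁻¹ := by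
  unfold expIntegralE
  rw [← MeasureTheory.integral_const_mul]
  have himage : (fun u : ℝ => u + z) '' Ioi 0 = Ioi z := by
    ext t
    constructor
    · rintro ⟨u, hu, rfl⟩
      simpa using hu
    · intro ht
      exact ⟨t - z, by simpa [sub_pos] using ht, by ring⟩
  have h := integral_image_eq_integral_abs_deriv_smul (s := Ioi (0 : ℝ)) (f := fun u : ℝ => u + z)
    (f' := fun _ => (1 : ℝ)) measurableSet_Ioi (fun u _ => ((hasDerivAt_id u).add_const z).hasDerivWithinAt)
    (fun a _ b _ h => by simpa using h) (fun t => exp z * (exp (-t) * (t ^ m)⁻¹))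
  rw [himage] at h
  rw [h]
  refine setIntegral_congr_fun measurableSet_Ioi fun u _ => ?_
  simp only [abs_one, one_smul]
  have hzu : exp z * exp (-(u + z)) = exp (-u) := by
    rw [← Real.exp_add]
    congr 1
    ring
  rw [← mul_assoc, hzu]

/-! ### The Taylor remainder of `eˣ` as the integral of a spline -/

/-- **Taylor's formula for `eˣ` with the truncated-power kernel on the fixed interval `[0, 1]`:** for
`0 ≤ x ≤ 1`, `eˣ = 1 + x + x²/2! + x³/3! + (1/3!) ∫₀¹ eᵗ (x - t)₊³ dt`, `(x - t)₊ = max (x - t) 0`.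
Approximating the integral by a compound Simpson rule turns the remainder into the cubic spline `S₃(x)` of the
text. [cite: DavisRabinowitz1984, Sect. 2.13.2] -/
theorem exp_eq_taylor3_add_integral_truncPow {x : ℝ} (hx0 : 0 ≤ x) (hx1 : x ≤ 1) :
    exp x = 1 + x + x ^ 2 / 2 + x ^ 3 / 6 + 1 / 6 * ∫ t in (0 : ℝ)..1, exp t * max (x - t) 0 ^ 3 := by
  have hcont : Continuous fun t : ℝ => exp t * max (x - t) 0 ^ 3 :=
    continuous_exp.mul (((continuous_const.sub continuous_id).max continuous_const).pow 3)
  -- split `[0, 1] = [0, x] ∪ [x, 1]`; the kernel vanishes on `[x, 1]`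
  rw [← intervalIntegral.integral_add_adjacent_intervals (hcont.intervalIntegrable 0 x)
    (hcont.intervalIntegrable x 1)]
  have hzero : ∫ t in x..1, exp t * max (x - t) 0 ^ 3 = 0 := by
    rw [← intervalIntegral.integral_zero (a := x) (b := (1 : ℝ))]
    refine intervalIntegral.integral_congr fun t ht => ?_
    rw [uIcc_of_le hx1] at ht
    simp [max_eq_right (sub_nonpos.mpr ht.1)]
  have hleft : ∫ t in (0 : ℝ)..x, exp t * max (x - t) 0 ^ 3 = ∫ t in (0 : ℝ)..x, exp t * (x - t) ^ 3 := by
    refine intervalIntegral.integral_congr fun t ht => ?_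
    rw [uIcc_of_le hx0] at ht
    simp [max_eq_left (sub_nonneg.mpr ht.2)]
  -- the explicit primitive `F(t) = eᵗ ((x-t)³ + 3(x-t)² + 6(x-t) + 6)`, `F' = eᵗ (x-t)³`
  have hF : ∀ t, HasDerivAt (fun t => exp t * ((x - t) ^ 3 + 3 * (x - t) ^ 2 + 6 * (x - t) + 6))
      (exp t * (x - t) ^ 3) t := by
    intro t
    have hq : HasDerivAt (fun t : ℝ => x - t) (-1) t := by
      simpa using (hasDerivAt_id t).const_sub x
    have hP : HasDerivAt (fun t : ℝ => (x - t) ^ 3 + 3 * (x - t) ^ 2 + 6 * (x - t) + 6)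
        (-(3 * (x - t) ^ 2 + 6 * (x - t) + 6)) t := by
      have h := (((hq.pow 3).add ((hq.pow 2).const_mul 3)).add (hq.const_mul 6)).add_const 6
      refine h.congr_deriv ?_
      norm_num
      ring
    refine ((Real.hasDerivAt_exp t).mul hP).congr_deriv ?_
    ring
  have hftc := intervalIntegral.integral_eq_sub_of_hasDerivAt (a := (0 : ℝ)) (b := x)
    (fun t _ => hF t) ((by fun_prop : Continuous fun t : ℝ => exp t * (x - t) ^ 3).intervalIntegrable 0 x)
  rw [hzero, add_zero, hleft, hftc]
  simp
  ring

end Literature.Analysis.Quadrature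

end
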